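import Summits.QuantumFields.BalabanUV.Beta.PropagatorWoodburyFibreTarget
import Summits.QuantumFields.BalabanUV.Beta.GAN24.DirichletExhaustionDeltaZSymm
import Summits.QuantumFields.BalabanUV.Beta.GAN24.DirichletExhaustionDecays
import Summits.QuantumFields.BalabanUV.Beta.GAN24.WoodburyFibreBlocks
import Summits.QuantumFields.BalabanUV.Beta.GAN24.TransverseDictionary

/-!
# GAN24 / WoodburyFibre — the BLOCK SPLIT of the (CONV-C) resolvent target and the REDUCTION OF ITS MULTIPLIER BLOCK to the
# tree's rate of Bałaban's `Δ_k` (gan24-p2's `deltaZ`), modulo ONE named dictionary; the field blocks as ONE named residual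

Cell `pub-balaban`, β sub-cell, BINDER ROW **G-an2-4 ∕ (CONV-C)** «non-abelian one-step η-rate comparison of the constituent kernels at
`U = 1`» — NOT IN PRINT; prover part **P3 = WOODBURY-FIBRE reduction** (unit `b2b-balaban-gan24-p3`, gen 2; the coordinator's file slot
`GAN24/WoodburyFibre.lean`).  HONEST FRAMING (verbatim): discharging `BetaPertH` makes Bałaban's UV stability UNCONDITIONAL — a real
constructive-QFT result; it is NOT the continuum limit and NOT the Clay problem.  HONEST DEPENDENCY: continuum YM on T⁴ ⇐ BetaPertH ∧ nine
spine estimates (0/9 proved); BetaPertH ⇐ (D1) ∧ (D4) ∧ CAP+tail; G-an2-4 gates asym, D1 and NE2/3/4.  LABEL: (CONV-C) is not in print; this is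
our proof attempt.  ABSOLUTE RULE honoured: no `Prop` is asserted of Bałaban's objects; the two `def … : Prop` below (`MultDict`,
`FieldBlocksRate`) are BINDER SHAPES (hypotheses of the theorems, asserted of nothing), everything else is `[folklore]` bookkeeping over the
cell's typed objects and gan24-p2's kernel theorems `deltaZ_abs_le` ∕ `deltaZ_step_abs_le` BY NAME.

## What is here (rows (d) and (e) of the census `HOME/b2b-balaban-gan24-p3/WOODBURY-FIBRE.md` v2)

PRIORITY ∕ RELATION (read after drafting): the swarm leaf `GAN24/TransverseDictionary` (gan24-formalise-leaf-18, leaf P1-L13, landed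
10 min earlier) carries the SAME multiplier-block reduction in gan24-p1's currency (`KStepUnit`, `UniformDecays`/`DecayCauchy`;
`mm_binders_of_dict`) with the dictionary as the explicit hypothesis `hdict`, plus the UNCONDITIONAL Green-pairing facts `wΦ_reciprocity`,
`lip2_curv_Hcol_Hcol` (`wΦ` IS the Gram matrix of an2's constrained minimisers — the (1.65)-object of the typed system).  This file states the
dictionary in EXACTLY their shape (`MultDict Lc c` ≡ their `hdict` at `d = 3`), identifies `blockMM = mmPart` (`blockMM_eq_mmPart`), and adds what
is not there: the statement in the wall's own END currency `ConvCResolvent` (asym1 ∕ `PropagatorWoodburyFibreTarget`), the block-split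
sockets, the named field-block residual and the assembly theorem.  The located gap is the same in both files: the junction an2-system ↔ b05
torus operators ((1.65) = (1.66) is certified on the torus: `B5Hk163Form166.DelK_form_eq_formDk`, `B6Cov2156TorusDelK.deltaPol_eq_DelK`).

The resolvent third of the wall is ONE predicate, `PropagatorWoodburyFibreTarget.ConvCResolvent Lc C δK cK θ` = `j`-uniform `Decays` of the
one-step-normalised resolvents `K_j^{(1)} := unitResolvent Lc j = D_j (KInvStep Lc j) D_j` AND all-scales deviations `cK·θ^k`, ENTRYWISE on the
packed fibre `Fib 3 = (field) ⊕ (multiplier)`.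
* §1 = part 1 `GAN24/WoodburyFibreBlocks` (BLOCK SPLIT, exit R8 (i) executed): `K = blockFF K + blockFM K + blockMF K + blockMM K`, the blocks
  commute with differences, `Decays` of the blocks ⇒ `Decays` of `K` (`decays_of_blocks`): the consumer (asym1's END
  `d1Drift_iff_of_convCResolvent`) may now be fed block by block.
* §2 THE MULTIPLIER BLOCK of `K_j^{(1)}`: it vanishes unless both legs sit at `Lc`-coarse points of the step-`j` lattice, and at
  `(Lc•u, Lc•u′)` it equals `s_m(j)² · wΦ^{(Lc^{j+1})} κ l (u − u′)` (`unitResolvent_inr_inr_coarse`; `s_m(j) = Lc^{4j}`) — an2's multiplier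
  response `wΦ` of the `(j+1)`-step composite system (= the coarse effective quadratic form, `OneStepResolventKernel` §1).
* §3 [shape] **`MultDict Lc c`** — THE MULTIPLIER DICTIONARY: `s_m(j)²·wΦ^{(Lc^{j+1})} κ l (u − u′) = c · deltaZ Lc (j+1) (u,κ) (u′,l)` for all
  `j, κ, l, u, u′`, where `deltaZ` is gan24-p2's `ℤ^{d+1}` twin of Bałaban's `Δ_k` (the position kernel of the third expression of (1.66)
  [cite: Balaban1984PropagatorsI, (1.66) p.29]).  CONTENT of the shape = «the multiplier block of the weak-gauge resolvent is gauge-INVARIANT and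
  equals Bałaban's effective form» ∧ «(1.65) = (1.66)» (the identity `B6Cov2156Torus` records as NOT certified package-wide) ∧ «the adopted units
  `s_m = Lc^{4j}` normalise it `j`-independently».  NUMERICAL STATUS (DIAGNOSTIC float64, job `j077931` of this seat, engine = gan24-p1's
  validated `kkt_fourier.kmat_closed`, sha16 f4bb3445fd4408d0, cross-checked against its arrow system to 1e-13): per Bloch fibre the multiplier
  block of `k_j^{(1)}(p)` equals `(2/Lc^{D+4}) ×` the matrix of `½Σ_{μν} w166(Lc^{j+1})|curlHat|²` (`B5Bounds167Lattice.formDk`'s integrand) with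
  relative residual ≤ 6·10⁻¹¹ (typically 10⁻¹⁵) for `(D,Lc) ∈ {(2,2),(2,3),(3,2),(4,2)}`, `j ≤ 6/3/4/3`, five momenta each, while the control
  `n = Lc^j` fails at 10⁻²…10⁻⁴ — i.e. `c = 2·Lc^{−8}` at `D = 4` (`deltaZ`'s symbol `Σ_{μ≠ν}` of `Gsym = ½·W166·(e^{−ip_a}−1)(e^{ip_b}−1)` IS that
  matrix, in the same `latticeKernel` normalisation as an2's `wΦ` — gan24-p1's `CombesThomasFibre.wΦ_eq_re_latticeKernel`).  A shape, NOT a fact: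
  its kernel proof is B4 §1 ((1.65) ⇒ (1.66)) for an2's typed system; nobody's hypothesis is discharged by the numerics.
* §4 **`decays_blockMM_of_multDict`**, **`decays_blockMM_sub_of_multDict`**: `MultDict Lc c` ⇒ the multiplier block satisfies BOTH rows of
  `ConvCResolvent` with the constants of gan24-p2's `deltaZ_abs_le` ∕ `deltaZ_step_abs_le` (`|c|·c166Z 3`, rate `kappaZ 3/(4·Lc)` in the step-`j`
  `ℓ¹` distance, all-scales constant `|c|·theta166Z 3·θ/(1 − θ)`, `θ = Lc⁻²`) — the tree's scalar-alias-sum rate (t4-ne2-p2's `kerRe_step2`, King's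
  exponent `n⁻²`) BY NAME.  This is the Woodbury-fibre REDUCTION of the census, COMPLETED IN KERNEL for the multiplier block.
* §5 [shape] **`FieldBlocksRate Lc C δK cK θ`** — THE RESIDUAL: the two rows of `ConvCResolvent` for the three FIELD blocks `FF + FM + MF` only.
  LOCATED CONTENT (census (d)): per fibre the field columns of the weak-gauge resolvent are «transverse part» + «pure gauge `χ̂(m)c/|∂(k_m)|²·∂(k_m)`
  with ONE block constant `c(source; p)`» (gan24-p1 SKELETON-P1 S1b′); the transverse ∕ gauge-invariant content is Bałaban's axial-gauge `H_k`,
  `C^{(k)}(𝟙)` (rates: `B5Hk163Rate*`, gan24-p2's `convC_balaban`), the pure-gauge part is the `N`-dependent weak-gauge SECTION — the fibre term no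
  scalar rate controls (an5-g13 `K1aNeg`); numerically (job `j077931`, O2) its one-step differences decay with ratios → `Lc²`.
* §6 **`convCResolvent_of_multDict_of_fieldBlocksRate`**: `MultDict ∧ FieldBlocksRate ⇒ ConvCResolvent` (constants added, rates `min`-ed) — the
  row's resolvent target with the multiplier third supplied by the tree's `Δ_k`-rate and EXACTLY ONE located residual.
NOT BetaPertH, NOT continuum, NOT Clay.
-/

noncomputable section

open Finset
open scoped BigOperators
open Literature.Probability.LatticeModels (Torus.proj)
open Literature.MathematicalPhysics.QuantumFieldTheory.Balaban1983to89
open Literature.MathematicalPhysics.QuantumFieldTheory.Balaban1983to89.Beta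
open ExpKernelCalculus (MKer Decays l1_natSmul)
open OneStepResolventKernel (Fib KInv quo_zsmul proj_zsmul eq_zsmul_quo_of_proj KInv_inr_inr_coarse)
open OneStepKernelFamily (KInvStep dec legSet legPt legW proj_pow_smul_eq_zero_iff KInvStep_inr_off)
open KernelSpecInstance (wΦ)
open Literature.MathematicalPhysics.QuantumFieldTheory.LatticeForm (quo)
open B12Sec2to5 (l1 l1_nonneg)
open B4Sect5Exhaustion (K)
open Summit.QuantumFields.BalabanUV.Beta.HessKerDressedUnits (unitK unitK_apply legScale legScale_inl legScale_inr)
open Summit.QuantumFields.BalabanUV.Beta.PropagatorWoodburyFibreTarget (sfStep smStep unitResolvent ConvCResolvent)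
open Summit.QuantumFields.BalabanUV.Beta.GAN24.DirichletExhaustionDeltaZ (deltaZ c166Z theta166Z kappaZ kappaZ_pos deltaZ_abs_le
  deltaZ_step_abs_le)
open Summit.QuantumFields.BalabanUV.Beta.GAN24.DirichletExhaustionDecays (exp_sup_le_exp_l1)
open Summit.QuantumFields.BalabanUV.Beta.GAN24.WoodburyFibreBlocks
open Summit.QuantumFields.BalabanUV.Beta.GAN24.TransverseDictionary (mmPart theta_lt_one)

namespace Summit.QuantumFields.BalabanUV.Beta.GAN24.WoodburyFibre

/-! ## §2 The multiplier block of the one-step-normalised resolvent `K_j^{(1)}` (`d + 1 = 4`) -/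

section Multiplier

variable {Lc : ℕ} [NeZero Lc]

omit [NeZero Lc] in
/-- Part 1's `blockMM` IS `TransverseDictionary.mmPart` (two names, one object). [folklore] -/
theorem blockMM_eq_mmPart {d : ℕ} (K : MKer (d + 1) (Fib d)) : blockMM K = mmPart K := by
  funext x y a b; rcases a with κ | κ <;> rcases b with l | l <;> rfl

/-- **The multiplier block at coarse points**: `K_j^{(1)}(Lc•u, Lc•u′)_{inr κ, inr l} = s_m(j)² · wΦ^{(Lc^{j+1})} κ l (u − u′)` — the decimation
reads the composite resolvent at `Lc^j•(Lc•u) = Lc^{j+1}•u`, where its multiplier block is an2's `wΦ` (`KInv_inr_inr_coarse`). [folklore] -/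
theorem unitResolvent_inr_inr_coarse (j : ℕ) (u u' : Fin (3 + 1) → ℤ) (κ l : Fin (3 + 1)) :
    unitResolvent Lc j ((Lc : ℤ) • u) ((Lc : ℤ) • u') (Sum.inr κ) (Sum.inr l) =
      smStep Lc j ^ 2 * wΦ (N := Lc ^ (j + 1)) κ l (u - u') := by
  unfold unitResolvent KInvStep
  rw [unitK_apply]
  simp only [legScale_inr, dec, legSet, legPt, legW, Finset.sum_singleton, one_mul]
  have hN : ((Lc ^ j : ℕ) : ℤ) * (Lc : ℤ) = ((Lc ^ (j + 1) : ℕ) : ℤ) := by push_cast; ring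
  rw [smul_smul, smul_smul, hN, KInv_inr_inr_coarse]
  ring

/-- The multiplier block vanishes when the LEFT leg is off the `Lc`-coarse points of the step-`j` lattice. [folklore] -/
theorem unitResolvent_inr_inr_off_left (j : ℕ) {x : Fin (3 + 1) → ℤ} (hx : Torus.proj Lc x ≠ 0) (y : Fin (3 + 1) → ℤ)
    (κ l : Fin (3 + 1)) : unitResolvent Lc j x y (Sum.inr κ) (Sum.inr l) = 0 := by
  unfold unitResolvent
  rw [unitK_apply, KInvStep_inr_off j hx]
  ring

/-- The multiplier block vanishes when the RIGHT leg is off the `Lc`-coarse points of the step-`j` lattice. [folklore] -/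
theorem unitResolvent_inr_inr_off_right (j : ℕ) (x : Fin (3 + 1) → ℤ) {y : Fin (3 + 1) → ℤ} (hy : Torus.proj Lc y ≠ 0)
    (κ l : Fin (3 + 1)) : unitResolvent Lc j x y (Sum.inr κ) (Sum.inr l) = 0 := by
  unfold unitResolvent KInvStep
  rw [unitK_apply]
  simp only [dec, legSet, legPt, legW, Finset.sum_singleton, one_mul]
  have hy' : Torus.proj (Lc ^ (j + 1)) (((Lc ^ j : ℕ) : ℤ) • y) ≠ 0 := by rwa [Ne, proj_pow_smul_eq_zero_iff]
  simp only [KInv, hy', and_false, if_false, mul_zero, zero_mul]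

end Multiplier

/-! ## §3 The multiplier dictionary (a binder SHAPE, asserted of nothing) -/

section Dictionary

/-- [shape] **THE MULTIPLIER DICTIONARY `MultDict Lc c`**: the one-step-normalised multiplier response of the `(j+1)`-step composite
weak-gauge system IS `c` times gan24-p2's `ℤ^{d+1}` twin `deltaZ Lc (j+1)` of Bałaban's `Δ_{j+1}` (third expression of (1.66)
[cite: Balaban1984PropagatorsI, (1.66) p.29]), with ONE `j`-independent constant `c`.  Content: gauge-invariance of the multiplier block ∧
«(1.65) = (1.66)» for the typed system ∧ the unit convention `s_m = Lc^{4j}`.  DIAGNOSTIC numerics (this seat's job `j077931`, gan24-p1's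
validated engine): holds per Bloch fibre to ≤ 6·10⁻¹¹ with `c = 2·Lc^{−8}` (`D = 4`; `(2,2),(2,3),(3,2)`: `c = 2·Lc^{−(D+4)}`); NOT a
certificate, NOT a hypothesis discharged.  Never cite this `def` as a fact. -/
def MultDict (Lc : ℕ) [NeZero Lc] (c : ℝ) : Prop :=
  ∀ (j : ℕ) (κ l : Fin (3 + 1)) (z : Fin (3 + 1) → ℤ),
    CombesThomas.smStep 3 Lc j ^ 2 * wΦ (N := Lc ^ (j + 1)) κ l z = c * deltaZ Lc (j + 1) (z, κ) (0, l)

/-- `MultDict` IS `TransverseDictionary`'s hypothesis `hdict` at `d = 3` (same statement; recorded for the reader). [folklore] -/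
theorem multDict_iff (Lc : ℕ) [NeZero Lc] (c : ℝ) :
    MultDict Lc c ↔ ∀ (j : ℕ) (κ l : Fin (3 + 1)) (z : Fin (3 + 1) → ℤ),
      CombesThomas.smStep 3 Lc j ^ 2 * wΦ (N := Lc ^ (j + 1)) κ l z = c * deltaZ Lc (j + 1) (z, κ) (0, l) := Iff.rfl

/-- `deltaZ` depends on the bond sites only through their difference. [folklore] -/
theorem deltaZ_pair (L : ℕ) [NeZero L] (k : ℕ) (u u' : Fin (3 + 1) → ℤ) (κ l : Fin (3 + 1)) :
    deltaZ L k (u, κ) (u', l) = deltaZ L k (u - u', κ) (0, l) := by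
  simp only [deltaZ, sub_zero]

/-- The dictionary in the two-point form used below (`s_m` of `PropagatorWoodburyFibreTarget` = `CombesThomas.smStep 3`, `ConvCBridge.smStep_eq`). [folklore] -/
theorem MultDict.apply {Lc : ℕ} [NeZero Lc] {c : ℝ} (h : MultDict Lc c) (j : ℕ) (κ l : Fin (3 + 1)) (u u' : Fin (3 + 1) → ℤ) :
    smStep Lc j ^ 2 * wΦ (N := Lc ^ (j + 1)) κ l (u - u') = c * deltaZ Lc (j + 1) (u, κ) (u', l) := by
  rw [deltaZ_pair]
  exact h j κ l (u - u')

end Dictionary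

/-! ## §4 The multiplier block of (CONV-C) from the dictionary and the tree's `Δ_k`-rate -/

section Telescoping

/-- Geometric telescoping: one-step differences `≤ a·θ^i` give all-scales differences `≤ a·θ^k/(1 − θ)` (`0 ≤ θ < 1`). [folklore] -/
theorem abs_sub_le_of_step_le {f : ℕ → ℝ} {a θ : ℝ} (ha : 0 ≤ a) (hθ0 : 0 ≤ θ) (hθ1 : θ < 1)
    (h : ∀ i, |f (i + 1) - f i| ≤ a * θ ^ i) (k j : ℕ) : |f (k + j) - f k| ≤ a * θ ^ k / (1 - θ) := by
  have h1 : 0 < 1 - θ := by linarith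
  have key : ∀ j, |f (k + j) - f k| ≤ a * θ ^ k * (1 - θ ^ j) / (1 - θ) := by
    intro j
    induction j with
    | zero => simp
    | succ j ih =>
        have e : f (k + (j + 1)) - f k = (f (k + j + 1) - f (k + j)) + (f (k + j) - f k) := by
          rw [← add_assoc]; ring
        rw [e]
        calc |(f (k + j + 1) - f (k + j)) + (f (k + j) - f k)|
            ≤ |f (k + j + 1) - f (k + j)| + |f (k + j) - f k| := abs_add_le _ _
          _ ≤ a * θ ^ (k + j) + a * θ ^ k * (1 - θ ^ j) / (1 - θ) := add_le_add (h (k + j)) ih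
          _ = a * θ ^ k * (1 - θ ^ (j + 1)) / (1 - θ) := by
              rw [pow_add, pow_succ]
              field_simp
              ring
  have hj : a * θ ^ k * (1 - θ ^ j) ≤ a * θ ^ k := by
    have := pow_nonneg hθ0 j
    have h0 : 0 ≤ a * θ ^ k := by positivity
    nlinarith
  exact (key j).trans (div_le_div_of_nonneg_right hj h1.le)

end Telescoping

section Rate

variable {Lc : ℕ} [NeZero Lc]

omit [NeZero Lc] in
/-- The `ℓ¹`-distance of coarse points scales: `|Lc•u − Lc•u′|₁ = Lc·|u − u′|₁`. [folklore] -/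
theorem l1_coarse (u u' : Fin (3 + 1) → ℤ) : l1 ((Lc : ℤ) • u - (Lc : ℤ) • u') = (Lc : ℝ) * l1 (u - u') := by
  rw [← smul_sub, l1_natSmul]

/-- The decay conversion: gan24-p2's sup-distance decay on the coarse index `e^{−κ·dist u u′}` is at most `e^{−(κ/(4Lc))·|Lc•u − Lc•u′|₁}`
on the step-`j` lattice. [folklore] -/
theorem exp_dist_le_exp_l1_coarse {κ_ : ℝ} (hκ : 0 ≤ κ_) (u u' : Fin (3 + 1) → ℤ) :
    Real.exp (-(κ_ * dist u u')) ≤ Real.exp (-(κ_ / (4 * Lc)) * l1 ((Lc : ℤ) • u - (Lc : ℤ) • u')) := by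
  have h := exp_sup_le_exp_l1 hκ u u'
  rw [l1_coarse]
  have hLc : (0 : ℝ) < Lc := by exact_mod_cast Nat.pos_of_ne_zero (NeZero.ne Lc)
  have hL0 : (Lc : ℝ) ≠ 0 := hLc.ne'
  have e : -(κ_ / (4 * Lc)) * ((Lc : ℝ) * l1 (u - u')) = -(κ_ / ((3 + 1 : ℕ) : ℝ)) * l1 (u - u') := by
    rw [show ((3 + 1 : ℕ) : ℝ) = 4 by norm_num]
    field_simp
  rw [e]
  exact h

/-- `0 ≤ c166Z 3` (read off gan24-p2's bound at one point). [folklore] -/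
theorem c166Z_nonneg : 0 ≤ c166Z 3 := by
  have h := deltaZ_abs_le (d := 3) 1 0 ((0 : Fin (3 + 1) → ℤ), (0 : Fin (3 + 1))) ((0 : Fin (3 + 1) → ℤ), (0 : Fin (3 + 1)))
  rw [dist_self, mul_zero, neg_zero, Real.exp_zero, mul_one] at h
  exact (abs_nonneg _).trans h

/-- `0 ≤ theta166Z 3` (likewise). [folklore] -/
theorem theta166Z_nonneg : 0 ≤ theta166Z 3 := by
  have h := deltaZ_step_abs_le (d := 3) 1 0 ((0 : Fin (3 + 1) → ℤ), (0 : Fin (3 + 1))) ((0 : Fin (3 + 1) → ℤ), (0 : Fin (3 + 1)))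
  rw [dist_self, mul_zero, neg_zero, Real.exp_zero, mul_one, pow_zero, mul_one] at h
  exact (abs_nonneg _).trans h

/-- **THE MULTIPLIER BLOCK OF (CONV-C), UNIFORM ROW**: under the dictionary, every `K_j^{(1)}` has a multiplier block decaying with gan24-p2's
constants for Bałaban's `Δ_k` — `|·| ≤ |c|·c166Z(3)·e^{−(kappaZ 3/(4Lc))·|x − y|₁}`, uniformly in `j` (`deltaZ_abs_le` BY NAME). [folklore] -/
theorem decays_blockMM_of_multDict {c : ℝ} (hdict : MultDict Lc c) (j : ℕ) :
    Decays (blockMM (unitResolvent Lc j)) (|c| * c166Z 3) (kappaZ 3 / (4 * Lc)) := by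
  intro x y a b
  have hE : 0 ≤ |c| * c166Z 3 * Real.exp (-(kappaZ 3 / (4 * Lc)) * l1 (x - y)) :=
    mul_nonneg (mul_nonneg (abs_nonneg c) c166Z_nonneg) (Real.exp_nonneg _)
  rcases a with κ | κ <;> rcases b with l | l
  · simpa [blockMM] using hE
  · simpa [blockMM] using hE
  · simpa [blockMM] using hE
  · simp only [blockMM]
    by_cases hx : Torus.proj Lc x = 0
    · by_cases hy : Torus.proj Lc y = 0
      · have hxu := eq_zsmul_quo_of_proj (N := Lc) hx
        have hyu := eq_zsmul_quo_of_proj (N := Lc) hy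
        set u := quo Lc x
        set u' := quo Lc y
        rw [hxu, hyu, unitResolvent_inr_inr_coarse, hdict.apply j κ l u u', abs_mul]
        have h1 := deltaZ_abs_le (d := 3) Lc (j + 1) (u, κ) (u', l)
        have h2 := exp_dist_le_exp_l1_coarse (Lc := Lc) (kappaZ_pos 3).le u u'
        calc |c| * |deltaZ Lc (j + 1) (u, κ) (u', l)| ≤ |c| * (c166Z 3 * Real.exp (-(kappaZ 3 * dist u u'))) :=
              mul_le_mul_of_nonneg_left h1 (abs_nonneg c)
          _ ≤ |c| * (c166Z 3 * Real.exp (-(kappaZ 3 / (4 * Lc)) * l1 ((Lc : ℤ) • u - (Lc : ℤ) • u'))) :=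
              mul_le_mul_of_nonneg_left (mul_le_mul_of_nonneg_left h2 c166Z_nonneg) (abs_nonneg c)
          _ = |c| * c166Z 3 * Real.exp (-(kappaZ 3 / (4 * Lc)) * l1 ((Lc : ℤ) • u - (Lc : ℤ) • u')) := by ring
      · rw [unitResolvent_inr_inr_off_right j x hy, abs_zero]; exact hE
    · rw [unitResolvent_inr_inr_off_left j hx, abs_zero]; exact hE

/-- The one-step rate constant of the multiplier block: `cMM Lc c = |c|·theta166Z(3)·θ/(1 − θ)`, `θ = Lc⁻²`. [folklore] -/
def cMM (Lc : ℕ) (c : ℝ) : ℝ := |c| * theta166Z 3 * (((Lc : ℝ) ^ 2)⁻¹ / (1 - ((Lc : ℝ) ^ 2)⁻¹))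

omit [NeZero Lc] in
/-- `0 ≤ cMM`. [folklore] -/
theorem cMM_nonneg (hLc : 2 ≤ Lc) (c : ℝ) : 0 ≤ cMM Lc c := by
  obtain ⟨h0, h1⟩ := theta_lt_one (Lc := Lc) hLc
  unfold cMM
  have : 0 < 1 - ((Lc : ℝ) ^ 2)⁻¹ := by linarith
  exact mul_nonneg (mul_nonneg (abs_nonneg c) theta166Z_nonneg) (div_nonneg h0 this.le)

/-- **THE MULTIPLIER BLOCK OF (CONV-C), ALL-SCALES ROW**: under the dictionary, `|blockMM(K_{k+j}^{(1)} − K_k^{(1)})| ≤ cMM·θ^k·e^{−(kappaZ 3/(4Lc))|x−y|₁}`,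
`θ = Lc⁻²`, for `Lc ≥ 2` — gan24-p2's one-step rate `deltaZ_step_abs_le` (t4-ne2-p2's `kerRe_step2`, King's exponent) summed geometrically. [folklore] -/
theorem decays_blockMM_sub_of_multDict (hLc : 2 ≤ Lc) {c : ℝ} (hdict : MultDict Lc c) (k j : ℕ) :
    Decays (blockMM (unitResolvent Lc (k + j)) - blockMM (unitResolvent Lc k)) (cMM Lc c * (((Lc : ℝ) ^ 2)⁻¹) ^ k)
      (kappaZ 3 / (4 * Lc)) := by
  obtain ⟨hθ0, hθ1⟩ := theta_lt_one (Lc := Lc) hLc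
  set θ := ((Lc : ℝ) ^ 2)⁻¹ with hθ
  intro x y a b
  have hE : 0 ≤ cMM Lc c * θ ^ k * Real.exp (-(kappaZ 3 / (4 * Lc)) * l1 (x - y)) :=
    mul_nonneg (mul_nonneg (cMM_nonneg hLc c) (pow_nonneg hθ0 k)) (Real.exp_nonneg _)
  rw [← blockMM_sub]
  rcases a with κ | κ <;> rcases b with l | l
  · simpa [blockMM] using hE
  · simpa [blockMM] using hE
  · simpa [blockMM] using hE
  · simp only [blockMM, Pi.sub_apply]
    by_cases hx : Torus.proj Lc x = 0
    · by_cases hy : Torus.proj Lc y = 0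
      · have hxu := eq_zsmul_quo_of_proj (N := Lc) hx
        have hyu := eq_zsmul_quo_of_proj (N := Lc) hy
        set u := quo Lc x
        set u' := quo Lc y
        rw [hxu, hyu, unitResolvent_inr_inr_coarse, unitResolvent_inr_inr_coarse, hdict.apply (k + j) κ l u u', hdict.apply k κ l u u',
          ← mul_sub, abs_mul]
        -- telescoping of p2's one-step rate along `i ↦ deltaZ Lc (i + 1)`
        have hstep : ∀ i, |deltaZ Lc (i + 1 + 1) (u, κ) (u', l) - deltaZ Lc (i + 1) (u, κ) (u', l)| ≤
            theta166Z 3 * θ * Real.exp (-(kappaZ 3 * dist u u')) * θ ^ i := by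
          intro i
          have h := deltaZ_step_abs_le (d := 3) Lc (i + 1) (u, κ) (u', l)
          calc |deltaZ Lc (i + 1 + 1) (u, κ) (u', l) - deltaZ Lc (i + 1) (u, κ) (u', l)|
              ≤ theta166Z 3 * θ ^ (i + 1) * Real.exp (-(kappaZ 3 * dist u u')) := h
            _ = theta166Z 3 * θ * Real.exp (-(kappaZ 3 * dist u u')) * θ ^ i := by rw [pow_succ]; ring
        have ha : 0 ≤ theta166Z 3 * θ * Real.exp (-(kappaZ 3 * dist u u')) :=
          mul_nonneg (mul_nonneg theta166Z_nonneg hθ0) (Real.exp_nonneg _)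
        have htel := abs_sub_le_of_step_le (f := fun i => deltaZ Lc (i + 1) (u, κ) (u', l)) ha hθ0 hθ1 hstep k j
        have h2 := exp_dist_le_exp_l1_coarse (Lc := Lc) (kappaZ_pos 3).le u u'
        have h1θ : 0 < 1 - θ := by linarith
        calc |c| * |deltaZ Lc (k + j + 1) (u, κ) (u', l) - deltaZ Lc (k + 1) (u, κ) (u', l)|
            ≤ |c| * (theta166Z 3 * θ * Real.exp (-(kappaZ 3 * dist u u')) * θ ^ k / (1 - θ)) :=
              mul_le_mul_of_nonneg_left htel (abs_nonneg c)
          _ = cMM Lc c * θ ^ k * Real.exp (-(kappaZ 3 * dist u u')) := by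
              simp only [cMM, ← hθ]; field_simp
          _ ≤ cMM Lc c * θ ^ k * Real.exp (-(kappaZ 3 / (4 * Lc)) * l1 ((Lc : ℤ) • u - (Lc : ℤ) • u')) :=
              mul_le_mul_of_nonneg_left h2 (mul_nonneg (cMM_nonneg hLc c) (pow_nonneg hθ0 k))
      · rw [unitResolvent_inr_inr_off_right (k + j) x hy, unitResolvent_inr_inr_off_right k x hy, sub_zero, abs_zero]; exact hE
    · rw [unitResolvent_inr_inr_off_left (k + j) hx, unitResolvent_inr_inr_off_left k hx, sub_zero, abs_zero]; exact hE

end Rate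

/-! ## §5 The residual: the field blocks, as ONE named shape -/

section Residual

/-- [shape] **THE FIELD-BLOCK RESIDUAL `FieldBlocksRate Lc C δK cK θ`**: the two rows of `ConvCResolvent` (uniform decay; all-scales rate
`cK·θ^k`) for the three FIELD blocks `blockF K_j^{(1)} = FF + FM + MF` of the one-step-normalised resolvents.  LOCATED CONTENT: transverse ∕
gauge-invariant part = Bałaban's axial-gauge `H_k`, `C^{(k)}(𝟙)` (tree rates ∕ gan24-p2's `convC_balaban`); pure-gauge part = the
`N`-dependent weak-gauge SECTION (per fibre `χ̂(m)·c(source;p)·∂(k_m)/|∂(k_m)|²`, gan24-p1 S1b′) — the fibre term that no scalar rate controls.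
A binder shape asserted of nothing; never a fact. -/
def FieldBlocksRate (Lc : ℕ) [NeZero Lc] (C δK cK θ : ℝ) : Prop :=
  (∀ j, Decays (blockF (unitResolvent Lc j)) C δK) ∧
    ∀ k j, Decays (blockF (unitResolvent Lc (k + j)) - blockF (unitResolvent Lc k)) (cK * θ ^ k) δK

end Residual

/-! ## §6 Assembly: the resolvent target from the dictionary and the one residual -/

section Assembly

variable {Lc : ℕ} [NeZero Lc]

/-- **(CONV-C), RESOLVENT THIRD, FROM THE MULTIPLIER DICTIONARY AND THE FIELD-BLOCK RESIDUAL**: `MultDict Lc c ∧ FieldBlocksRate Lc C δK cK θ`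
with `Lc ≥ 2`, `Lc⁻² ≤ θ`, `δK ≤ kappaZ 3/(4Lc)` ⟹ `ConvCResolvent Lc (C + |c|·c166Z 3) δK (cK + cMM Lc c) θ`.
The multiplier third is supplied by the tree's `Δ_k`-rate; the field third is the ONE located residual. [folklore] -/
theorem convCResolvent_of_multDict_of_fieldBlocksRate (hLc : 2 ≤ Lc) {c C δK cK θ : ℝ} (hdict : MultDict Lc c)
    (hF : FieldBlocksRate Lc C δK cK θ) (hθ : ((Lc : ℝ) ^ 2)⁻¹ ≤ θ) (hδ : δK ≤ kappaZ 3 / (4 * Lc)) :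
    ConvCResolvent Lc (C + |c| * c166Z 3) δK (cK + cMM Lc c) θ := by
  obtain ⟨hθ0, _⟩ := theta_lt_one (Lc := Lc) hLc
  refine ⟨fun j => ?_, fun k j => ?_⟩
  · have hM := OneStepResolventKernel.decays_mono (decays_blockMM_of_multDict hdict j)
      (mul_nonneg (abs_nonneg c) c166Z_nonneg) le_rfl hδ
    exact decays_of_blockF_blockMM (hF.1 j) hM
  · have hM0 := decays_blockMM_sub_of_multDict hLc hdict k j
    have hM : Decays (blockMM (unitResolvent Lc (k + j)) - blockMM (unitResolvent Lc k)) (cMM Lc c * θ ^ k) δK :=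
      OneStepResolventKernel.decays_mono hM0 (mul_nonneg (cMM_nonneg hLc c) (pow_nonneg hθ0 k))
        (mul_le_mul_of_nonneg_left (pow_le_pow_left₀ hθ0 hθ k) (cMM_nonneg hLc c)) hδ
    have h := decays_add (hF.2 k j) hM
    have e : blockF (unitResolvent Lc (k + j)) - blockF (unitResolvent Lc k) +
        (blockMM (unitResolvent Lc (k + j)) - blockMM (unitResolvent Lc k)) =
        unitResolvent Lc (k + j) - unitResolvent Lc k := by
      rw [← blockF_sub, ← blockMM_sub, blockF_add_blockMM]
    rw [e] at h
    have e2 : cK * θ ^ k + cMM Lc c * θ ^ k = (cK + cMM Lc c) * θ ^ k := by ring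
    rwa [e2] at h

end Assembly

end Summit.QuantumFields.BalabanUV.Beta.GAN24.WoodburyFibre

end
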